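import Summits.QuantumFields.BalabanUV.Beta.FP.CoarseCovarianceAlias
import Summits.QuantumFields.BalabanUV.Beta.FP.PerfectPropagatorBound

/-!
# `BalabanUV.Beta.FP.CoarseCovarianceAliasBF` — road «FP» (binder row D1), row H′2-IR ∕ IR-2 leaf (i) «COARSE COVARIANCE SYMBOL», file 3∕3:
# THE BF INSTANCE — the periodic complex-momentum extension `PbfSym κ λ` of the unconstrained perfect (BF-Feynman, `ξ = 1`) propagator symbol
# `s ↦ PinfSym s (d1Sym s) κ λ` (p231001), and `Q_n P^{BF} Q_nᵀ = latticeKernel (Ĉ_n^{BF}) (u − v)` with `Ĉ_n^{BF} = covSym n κ λ (PbfSym κ λ)`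

NOT IN PRINT; OUR BOOKKEEPING, for the road-FP OWNER's ROW REFINEMENT «IR-2 (i)–(iii) SWARM-READY NOW» (journal l.21049; `H2IR-DESIGN.md` §IR-2 (i)).  The x-space
propagator `P^{BF}_{κλ} := latticeKernel (…)` is the owner's to define (row H2-P-KER-ASM); this file is stated for ANY complex-momentum extension `G₀` that agrees
with `PinfSym s (d1Sym s) κ λ` on the real zone (gan24-leaf-05-g34's convention, `PerfectPropagatorBound.integrableOn_integrand_of_eq_PinfSym`), and supplies
the PERIODIC extension the alias sum needs (`Ĉ_n` reads the fine symbol at the alias momenta `(k + 2πl)∕n ∈ [−π∕n, 2π − π∕n]^{d+1}`, OUTSIDE `[−π,π]^{d+1}`):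
`PbfSym κ λ P := PinfSym (wrapPt (Re P)) (d1Sym (wrapPt (Re P))) κ λ`, `wrapPt` = coordinatewise reduction to `(−π, π]` (Mathlib `toIocMod`).  Agreement with
`G₀` holds on the half-open zone `∏ (−π,π]`, i.e. Lebesgue-a.e. on `[−π,π]^{d+1}`, which is all `latticeKernel` sees (`latticeKernel_congr_ae`); no side-matching
of `W_∞` is needed.  Integrability: `PerfectPropagatorBound.integrableOn_PinfSym_d1Sym` (`3 ≤ d+1`; road `d+1 = 4`) BY NAME.

## What is proved (`0 sorry`; `3 ≤ d+1` where integrability enters)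
* §1 [folklore] `wrapPt`, `wrapPt_mem_Ioc`, `wrapPt_mem_BZ`, `wrapPt_update_add_two_pi` (periodicity), `wrapPt_eq_self` (on `∏(−π,π]`), `pi_Ioc_ae_eq_BZ`,
  `ae_restrict_BZ_wrapPt_eq` (`wrapPt p = p` for a.e. `p ∈ BZ`), `latticeKernel_congr_ae`.
* §2 [our object] `PbfSym κ λ`; `PbfSym_periodic`, `PbfSym_ofRealVec` (`= PinfSym (wrapPt s) (d1Sym (wrapPt s)) κ λ`), `PbfSym_ofRealVec_of_mem` (`= PinfSym s (d1Sym s) κ λ`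
  on `∏(−π,π]`), `PbfSym_ae_eq`, **`integrableOn_PbfSym`**, **`latticeKernel_eq_PbfSym`** (`latticeKernel G₀ = latticeKernel (PbfSym κ λ)` for every extension `G₀`
  agreeing with `PinfSym ∘ d1Sym` on the zone).
* §3 [our object] **`coarseCov_latticeKernel_BF`**: for `3 ≤ d+1`, every `G₀` with `G₀ (ofRealVec s) = PinfSym s (d1Sym s) κ λ` on the zone and `K κ λ = latticeKernel G₀`:
  `coarseCov n K κ λ u v = latticeKernel (covSym n κ λ (PbfSym κ λ)) (u − v)` — `C_n = Q_n P^{BF} Q_nᵀ` IS coarse-translation-invariant with the alias-sum symbol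
  `Ĉ_n^{BF}`; **`coarseCovMean_latticeKernel_BF`** (the same for the owner's symbol of record `Ĉ_n^{BF,mean} = (n^{d+2})⁻²·Ĉ_n^{BF}`, R-FP-21 (C));
  **`covSym_PbfSym_ofRealVec`** (the explicit `q̂·P̂·q̂†` alias formula at real coarse momenta: `n^{−(d+1)} Σ_l cweight n κ (k_l)·PinfSym (wrapPt k_l)
  (d1Sym (wrapPt k_l)) κ λ·conj (cweight n λ (k_l))`, `k_l = (k + 2πl)∕n`); `integrableOn_integrand_covSym_PbfSym`, `covSym_PbfSym_periodic`.
WHAT IS NOT HERE: (ii) strip split ∕ analyticity, (iii) ellipticity, (iv)–(v) inverse + decay; the normalisation of record (owner, Q-leaf02-g7-1; scaling lemma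
`CoarseCovarianceAlias.coarseCov_latticeKernel_scaled`); any estimate.
HONEST FRAMING: a symbol identity for the cell's own `U = 1` objects; 0 estimates of Bałaban's objects; 0∕4 row-D1 binders; NOT D1, NOT BetaPertH, NOT the continuum
limit, NOT Clay.  HONEST DEPENDENCY (verbatim): «continuum YM on T⁴ ⇐ BetaPertH ∧ nine spine estimates (0/9 proved); BetaPertH ⇐ (D1) ∧ (D4) ∧ CAP+tail; G-an2-4
gates asym, D1 and NE2/3/4.»  ABSOLUTE RULE respected: no cited fact, no `def … : Prop`, nothing of the manuscripts asserted.
Provenance: D1 formalisation swarm leaf prover 02, gen 7 (prover-b2b-balaban-beta-d1-formalise-leaf-02-g7-0), road-FP row IR-2 (i), 2026-08-20.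
-/

noncomputable section

open Complex Set MeasureTheory Finset
open scoped Real BigOperators ComplexConjugate
open Literature.MathematicalPhysics.QuantumFieldTheory.Balaban1983to89
open Literature.MathematicalPhysics.QuantumFieldTheory.Balaban1983to89.Beta
open B4Strip (ofRealVec reVec)
open B4ContourShift (BZ phase integrand fourierBox latticeKernel)
open B5Prop11Fiber (d1Sym)
open AffineAveraging (Site)
open Summit.QuantumFields.BalabanUV.Beta.GAN24.AliasTiling (apt)
open Summit.QuantumFields.BalabanUV.Beta.GAN24.PushSumSymbol (cweight)
open Summit.QuantumFields.BalabanUV.Beta.FP.PerfectPropagatorSymbol (PinfSym)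
open Summit.QuantumFields.BalabanUV.Beta.FP.PerfectPropagatorBound (integrableOn_PinfSym_d1Sym)
open Summit.QuantumFields.BalabanUV.Beta.FP.AliasDecimateIntegrable (measurableSet_BZ)
open Summit.QuantumFields.BalabanUV.Beta.FP.CoarseCovarianceAlias (coarseCov covSym coarseCov_latticeKernel covSym_ofRealVec covSym_periodic
  integrableOn_integrand_covSym coarseCovMean covSymMean coarseCovMean_latticeKernel)

namespace Summit.QuantumFields.BalabanUV.Beta.FP.CoarseCovarianceAliasBF

variable {d : ℕ}

/-! ## §1 Coordinatewise reduction to the half-open zone `∏ (−π, π]` -/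

/-- [folklore] Coordinatewise reduction of a real momentum to the half-open zone `(−π, π]^{d+1}` (Mathlib `toIocMod`). -/
def wrapPt (s : Fin (d + 1) → ℝ) : Fin (d + 1) → ℝ := fun i => toIocMod Real.two_pi_pos (-π) (s i)

/-- [folklore] Every coordinate of the wrapped point lies in `(−π, π]`. -/
theorem wrapPt_mem_Ioc (s : Fin (d + 1) → ℝ) (i : Fin (d + 1)) : wrapPt s i ∈ Set.Ioc (-π) π := by
  have h := toIocMod_mem_Ioc Real.two_pi_pos (-π) (s i)
  have e : -π + 2 * π = π := by ring
  rw [e] at h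
  exact h

/-- [folklore] The wrapped point lies in the closed zone. -/
theorem wrapPt_mem_BZ (s : Fin (d + 1) → ℝ) : wrapPt s ∈ BZ (d + 1) := by
  unfold BZ
  rw [Set.mem_Icc]
  exact ⟨fun i => (wrapPt_mem_Ioc s i).1.le, fun i => (wrapPt_mem_Ioc s i).2⟩

/-- [folklore] PERIODICITY: wrapping forgets a shift by `2π` in any coordinate. -/
theorem wrapPt_update_add_two_pi (s : Fin (d + 1) → ℝ) (i : Fin (d + 1)) :
    wrapPt (Function.update s i (s i + 2 * π)) = wrapPt s := by
  funext j
  unfold wrapPt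
  by_cases hj : j = i
  · subst hj
    rw [Function.update_self, toIocMod_add_right]
  · rw [Function.update_of_ne hj]

/-- [folklore] On the half-open zone wrapping is the identity. -/
theorem wrapPt_eq_self {s : Fin (d + 1) → ℝ} (hs : s ∈ Set.pi Set.univ fun _ : Fin (d + 1) => Set.Ioc (-π) π) : wrapPt s = s := by
  funext i
  unfold wrapPt
  rw [toIocMod_eq_self]
  have h := hs i (Set.mem_univ i)
  have e : -π + 2 * π = π := by ring
  rw [e]
  exact h

/-- [folklore] The half-open zone is the closed zone up to a Lebesgue-null set. -/
theorem pi_Ioc_ae_eq_BZ : (Set.pi Set.univ fun _ : Fin (d + 1) => Set.Ioc (-π) π) =ᵐ[volume] BZ (d + 1) := by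
  unfold BZ
  rw [volume_pi]
  exact Measure.univ_pi_Ioc_ae_eq_Icc

/-- [folklore] For a.e. point of the zone, wrapping is the identity. -/
theorem ae_restrict_BZ_wrapPt_eq : ∀ᵐ p ∂(volume.restrict (BZ (d + 1))), wrapPt p = p := by
  rw [← Measure.restrict_congr_set pi_Ioc_ae_eq_BZ]
  have hmeas : MeasurableSet (Set.pi Set.univ fun _ : Fin (d + 1) => Set.Ioc (-π) π) :=
    MeasurableSet.univ_pi fun _ => measurableSet_Ioc
  filter_upwards [ae_restrict_mem hmeas] with p hp
  exact wrapPt_eq_self hp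

/-- [folklore] Multipliers that agree a.e. on the real zone have the same lattice kernel. -/
theorem latticeKernel_congr_ae {G₁ G₂ : (Fin (d + 1) → ℂ) → ℂ} (h : ∀ᵐ p ∂(volume.restrict (BZ (d + 1))), G₁ (ofRealVec p) = G₂ (ofRealVec p))
    (x : Fin (d + 1) → ℤ) : latticeKernel G₁ x = latticeKernel G₂ x := by
  unfold latticeKernel fourierBox
  congr 1
  refine integral_congr_ae ?_
  filter_upwards [h] with p hp
  unfold integrand
  rw [hp]

/-! ## §2 The periodic BF propagator symbol -/

/-- [our object] **THE PERIODIC BF PROPAGATOR SYMBOL** (entry `(κ, λ)`) on complex momenta: `PbfSym κ λ P := PinfSym (wrapPt (Re P)) (d1Sym (wrapPt (Re P))) κ λ` —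
the unconstrained perfect BF-Feynman propagator symbol (p231001) read at the reduction of `Re P` to `(−π,π]^{d+1}`; globally `2π`-periodic in each coordinate and
equal to `PinfSym s (d1Sym s) κ λ` at every real `s` of the half-open zone. -/
def PbfSym (κ l : Fin (d + 1)) (P : Fin (d + 1) → ℂ) : ℂ := PinfSym (wrapPt (reVec P)) (d1Sym (wrapPt (reVec P))) κ l

/-- [folklore] `Re` of a coordinate update by `2π` is the update of `Re` by `2π`. -/
theorem reVec_update_add_two_pi (P : Fin (d + 1) → ℂ) (i : Fin (d + 1)) :
    reVec (Function.update P i (P i + 2 * π)) = Function.update (reVec P) i (reVec P i + 2 * π) := by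
  funext j
  by_cases hj : j = i
  · subst hj; simp [reVec]
  · simp [reVec, Function.update_of_ne hj]

/-- [our object] **GLOBAL `2π`-PERIODICITY** of `PbfSym κ λ` in each complex coordinate. -/
theorem PbfSym_periodic (κ l : Fin (d + 1)) (i : Fin (d + 1)) (P : Fin (d + 1) → ℂ) :
    PbfSym κ l (Function.update P i (P i + 2 * π)) = PbfSym κ l P := by
  unfold PbfSym
  rw [reVec_update_add_two_pi, wrapPt_update_add_two_pi]

/-- [folklore] `Re (ofRealVec s) = s`. -/
theorem reVec_ofRealVec (s : Fin (d + 1) → ℝ) : reVec (ofRealVec s) = s := by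
  funext i; simp [reVec, ofRealVec]

/-- [our object] At a real momentum: `PbfSym κ λ (ofRealVec s) = PinfSym (wrapPt s) (d1Sym (wrapPt s)) κ λ`. -/
theorem PbfSym_ofRealVec (κ l : Fin (d + 1)) (s : Fin (d + 1) → ℝ) :
    PbfSym κ l (ofRealVec s) = PinfSym (wrapPt s) (d1Sym (wrapPt s)) κ l := by
  unfold PbfSym
  rw [reVec_ofRealVec]

/-- [our object] On the half-open zone: `PbfSym κ λ (ofRealVec s) = PinfSym s (d1Sym s) κ λ`. -/
theorem PbfSym_ofRealVec_of_mem (κ l : Fin (d + 1)) {s : Fin (d + 1) → ℝ} (hs : s ∈ Set.pi Set.univ fun _ : Fin (d + 1) => Set.Ioc (-π) π) :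
    PbfSym κ l (ofRealVec s) = PinfSym s (d1Sym s) κ l := by
  rw [PbfSym_ofRealVec, wrapPt_eq_self hs]

/-- [our object] `PbfSym κ λ ∘ ofRealVec = PinfSym · (d1Sym ·) κ λ` a.e. on the zone. -/
theorem PbfSym_ae_eq (κ l : Fin (d + 1)) :
    ∀ᵐ p ∂(volume.restrict (BZ (d + 1))), PbfSym κ l (ofRealVec p) = PinfSym p (d1Sym p) κ l := by
  filter_upwards [ae_restrict_BZ_wrapPt_eq] with p hp
  rw [PbfSym_ofRealVec, hp]

/-- [our object] **INTEGRABILITY ON THE ZONE** (`3 ≤ d+1`): `PbfSym κ λ ∘ ofRealVec` is integrable on `[−π,π]^{d+1}` — gan24-leaf-05-g34's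
`PerfectPropagatorBound.integrableOn_PinfSym_d1Sym` BY NAME, transported along the a.e. equality. -/
theorem integrableOn_PbfSym (hd : 3 ≤ d + 1) (κ l : Fin (d + 1)) :
    IntegrableOn (fun p => PbfSym κ l (ofRealVec p)) (BZ (d + 1)) := by
  refine (integrableOn_PinfSym_d1Sym hd κ l).congr_fun_ae ?_
  filter_upwards [PbfSym_ae_eq κ l] with p hp
  exact hp.symm

/-- [our object] **EVERY EXTENSION OF THE BF SYMBOL HAS THE LATTICE KERNEL OF THE PERIODIC ONE**: if `G₀ (ofRealVec s) = PinfSym s (d1Sym s) κ λ` on the zone, then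
`latticeKernel G₀ = latticeKernel (PbfSym κ λ)` (a.e. agreement on the zone). -/
theorem latticeKernel_eq_PbfSym {G₀ : (Fin (d + 1) → ℂ) → ℂ} {κ l : Fin (d + 1)} (hG₀ : ∀ s ∈ BZ (d + 1), G₀ (ofRealVec s) = PinfSym s (d1Sym s) κ l)
    (x : Fin (d + 1) → ℤ) : latticeKernel G₀ x = latticeKernel (PbfSym κ l) x := by
  refine latticeKernel_congr_ae ?_ x
  filter_upwards [ae_restrict_mem measurableSet_BZ, PbfSym_ae_eq κ l] with p hp hq
  rw [hG₀ p hp, hq]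

/-! ## §3 The instance: `Q_n P^{BF} Q_nᵀ` is the coarse lattice kernel of `covSym n κ λ (PbfSym κ λ)` -/

/-- [our object] **THE COARSE COVARIANCE OF THE BF PROPAGATOR IS COARSE-TRANSLATION-INVARIANT WITH THE ALIAS-SUM SYMBOL `Ĉ_n^{BF} = covSym n κ λ (PbfSym κ λ)`**:
for `3 ≤ d+1` (road: `4`), every complex-momentum extension `G₀` of the entry `s ↦ PinfSym s (d1Sym s) κ λ` and `K κ λ = latticeKernel G₀` (the x-space BF propagator,
row H2-P-KER-ASM), `coarseCov n K κ λ u v = latticeKernel (covSym n κ λ (PbfSym κ λ)) (u − v)`. -/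
theorem coarseCov_latticeKernel_BF (hd : 3 ≤ d + 1) (n : ℕ) [NeZero n] {K : Fin (d + 1) → Fin (d + 1) → Site (d + 1) → ℂ}
    {G₀ : (Fin (d + 1) → ℂ) → ℂ} {κ l : Fin (d + 1)} (hG₀ : ∀ s ∈ BZ (d + 1), G₀ (ofRealVec s) = PinfSym s (d1Sym s) κ l)
    (hK : ∀ x, K κ l x = latticeKernel G₀ x) (u v : Site (d + 1)) :
    coarseCov n K κ l u v = latticeKernel (covSym n κ l (PbfSym κ l)) (u - v) :=
  coarseCov_latticeKernel n (fun x => (hK x).trans (latticeKernel_eq_PbfSym hG₀ x)) (PbfSym_periodic κ l) (integrableOn_PbfSym hd κ l) u v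

/-- [our object] **THE SAME FOR THE SYMBOL OF RECORD** (mass-one normalisation, owner ruling R-FP-21 (C)): `coarseCovMean n K κ λ u v = latticeKernel (covSymMean n κ λ (PbfSym κ λ)) (u − v)`
— the mass-one coarse covariance `Q_n^{mean} P^{BF} (Q_n^{mean})ᵀ` of the BF propagator is the coarse lattice kernel of `Ĉ_n^{BF,mean} := (n^{d+2})⁻²·covSym n κ λ (PbfSym κ λ)`. -/
theorem coarseCovMean_latticeKernel_BF (hd : 3 ≤ d + 1) (n : ℕ) [NeZero n] {K : Fin (d + 1) → Fin (d + 1) → Site (d + 1) → ℂ}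
    {G₀ : (Fin (d + 1) → ℂ) → ℂ} {κ l : Fin (d + 1)} (hG₀ : ∀ s ∈ BZ (d + 1), G₀ (ofRealVec s) = PinfSym s (d1Sym s) κ l)
    (hK : ∀ x, K κ l x = latticeKernel G₀ x) (u v : Site (d + 1)) :
    coarseCovMean n K κ l u v = latticeKernel (covSymMean n κ l (PbfSym κ l)) (u - v) :=
  coarseCovMean_latticeKernel n (fun x => (hK x).trans (latticeKernel_eq_PbfSym hG₀ x)) (PbfSym_periodic κ l) (integrableOn_PbfSym hd κ l) u v

/-- [our object] **THE EXPLICIT ALIAS FORMULA AT REAL COARSE MOMENTA** (`q̂·P̂·q̂†`):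
`Ĉ_n^{BF}(k)_{κλ} = (n^{d+1})⁻¹ Σ_{l ∈ {0,…,n−1}^{d+1}} cweight n κ (k_l) · PinfSym (wrapPt k_l) (d1Sym (wrapPt k_l)) κ λ · conj (cweight n λ (k_l))`,
`k_l = (k + 2πl)∕n` (`AliasTiling.apt`; `cweight` is `2π`-periodic, so only the propagator needs the wrap). -/
theorem covSym_PbfSym_ofRealVec (n : ℕ) (κ l : Fin (d + 1)) (k : Fin (d + 1) → ℝ) :
    covSym n κ l (PbfSym κ l) (ofRealVec k) = ((n : ℂ) ^ (d + 1))⁻¹ *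
      ∑ a : Fin (d + 1) → Fin n, cweight n κ (ofRealVec (apt n a k)) *
        PinfSym (wrapPt (apt n a k)) (d1Sym (wrapPt (apt n a k))) κ l * conj (cweight n l (ofRealVec (apt n a k))) := by
  rw [covSym_ofRealVec]
  simp only [PbfSym_ofRealVec]

/-- [our object] The integrand of `Ĉ_n^{BF}` is integrable on the coarse zone (`3 ≤ d+1`). -/
theorem integrableOn_integrand_covSym_PbfSym (hd : 3 ≤ d + 1) (n : ℕ) [NeZero n] (κ l : Fin (d + 1)) (z : Site (d + 1)) :
    IntegrableOn (integrand (covSym n κ l (PbfSym κ l)) z) (BZ (d + 1)) :=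
  integrableOn_integrand_covSym n κ l (PbfSym_periodic κ l) (integrableOn_PbfSym hd κ l) z

/-- [our object] `Ĉ_n^{BF}` is globally `2π`-periodic in each coarse coordinate. -/
theorem covSym_PbfSym_periodic (n : ℕ) [NeZero n] (κ l : Fin (d + 1)) (i : Fin (d + 1)) (P : Fin (d + 1) → ℂ) :
    covSym n κ l (PbfSym κ l) (Function.update P i (P i + 2 * π)) = covSym n κ l (PbfSym κ l) P :=
  covSym_periodic n κ l (PbfSym_periodic κ l) i P

end Summit.QuantumFields.BalabanUV.Beta.FP.CoarseCovarianceAliasBF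

end
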